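import Mathlib
import HarnessLib
import Literature.NumberTheory.LFunctions.RiemannXi

/-!
# RiemannHypothesis / DeBrangesSuzukiDoor — the single-operator objects `Θ_θ`, `K_θ`, `W_θ`

Route `route-RiemannHypothesis-DeBrangesSuzukiDoor` (column DBR of the RH ladder, D-0040/D-0059; cell
`rh-dbr`, theory memo TARGET-v3 §G). This `Defs` file fixes, for the port of the cell's scratch module
`SuzukiCanonicalWindow.lean` (sha16 `82bfcc5f80debbaf`, §v3, referee read PASS 2026-08-25T19:28Z) into the
tree, the three RH-free objects of Suzuki's single-operator door and two hypothesis packages: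

* `limTheta θ z = exp(-2θ (ξ'/ξ)(1/2 - i z))` — the symbol ([Su20] = M. Suzuki, *An integral operator …*,
  ASPM 84 (2020), arXiv:1907.07302, (1.10));
* `limKernel θ x = Re (2π)⁻¹ ∫_ℝ Θ_θ(u+i) e^{-i(u+i)x} du` — the kernel `K_θ`, RH-free spectral definition on
  the line `Im z = 1` (`Re s = 3/2`, absolute convergence of the Dirichlet series; junk `0` where the line
  integral diverges — never for `θ > 10`, see `DeBrangesSuzukiDoorLineIntegrable`);
* `limWindowAvg θ x = ∫_0^1 K_θ(x+y) dy` — the unit-window average `W_θ`;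
* `unitLaplace z = ∫_0^1 e^{-izy} dy` — Laplace transform of the unit window (the denominator `F` in H1);
* `LimKernelLaplaceIdentityOn θ c`, `LimKernelBasicOn θ c` — the K4-type Laplace identity on `Im z > c` and
  the kernel package (continuity, vanishing on `(-∞,0)`, growth `≤ C e^{cx}`, Laplace identity).

The bodies of `limTheta`/`limKernel` are VERBATIM the `let Θ` / `let K` of the route items (so the route
decls unfold to statements about these objects by `rfl`), and verbatim the pending Literature definitions
of `Literature/NumberTheory/LFunctions/SuzukiSingleOperatorKernel.lean` (p402789). The line transform is
written out instead of using `Literature.NumberTheory.LFunctions.invFourierLine` ONLY because the hub olean of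
`Literature.NumberTheory.LFunctions.SuzukiCanonicalSystem` is incoherent at filing time (operator note
2026-08-25T20:36:53Z); the two expressions agree by `rfl`.

Everything here is RH-FREE bookkeeping (definitions and `Prop`-valued packages); nothing in this file
bears on the truth of RH.
-/

noncomputable section

-- D-0017: `Summit.<S>.<S>.…` is the designed namespace of a single-problem summit.
set_option linter.dupNamespace false

open MeasureTheory Complex

namespace Summit.RiemannHypothesis.RiemannHypothesis.Theorems.SuzukiDoor

open Literature.NumberTheory.LFunctions

/-- RH-FREE object. Suzuki's single symbol `Θ_θ(z) = exp(-2θ (ξ'/ξ)(1/2 - iz))`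
([Su20] arXiv:1907.07302 (1.10)); `ξ` = `Literature.NumberTheory.LFunctions.riemannXi` (entire), junk
`ξ'/ξ := 0` at zeros of `ξ` (Lean division). Verbatim the route's `let Θ`. -/
def limTheta (θ : ℝ) (z : ℂ) : ℂ :=
  Complex.exp (-2 * (θ : ℂ) *
    (deriv riemannXi (1 / 2 - Complex.I * z) / riemannXi (1 / 2 - Complex.I * z)))

/-- RH-FREE object. The single kernel `K_θ(x) = Re (1/2π) ∫_ℝ Θ_θ(u + i) e^{-i(u+i)x} du`: the inverse
Fourier–Laplace integral of `Θ_θ` on the line `Im z = 1` ([Su20] Thm 1.2 with the spectral definition;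
real part taken, junk `0` if the line integral diverges). Verbatim the route's `let K`
(= `(invFourierLine (limTheta θ) 1 x).re` of the Literature module, written out). -/
def limKernel (θ : ℝ) (x : ℝ) : ℝ :=
  ((1 : ℂ) / (2 * (Real.pi : ℂ)) *
    ∫ u : ℝ, limTheta θ ((u : ℂ) + ((1 : ℝ) : ℂ) * Complex.I) *
      Complex.exp (-Complex.I * ((u : ℂ) + ((1 : ℝ) : ℂ) * Complex.I) * (x : ℂ))).re

/-- RH-FREE object. The unit-window average `W_θ(x) = ∫_0^1 K_θ(x + y) dy = ∫_x^{x+1} K_θ`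
([Su20]-type window function of the single operator; the route's `DoorWitness`/`WitnessDetectsRH` speak
of `MemLp (limWindowAvg θ) 2`). -/
def limWindowAvg (θ : ℝ) (x : ℝ) : ℝ :=
  ∫ y in Set.Ioo (0 : ℝ) 1, limKernel θ (x + y)

/-- RH-FREE hypothesis package (K4 on the half-plane `Im z > c`): for every `z` with `Im z > c`,
`x ↦ K_θ(x) e^{izx}` is integrable on `(0,∞)` and `∫_0^∞ K_θ(x) e^{izx} dx = Θ_θ(z)` ([Su20] Thm 1.2
(K-ii), printed for `θ > 1`, `Im z > 1/2`). For `c = 1` this is verbatim the route item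
`KernelLaplaceIdentity` at `θ`. -/
def LimKernelLaplaceIdentityOn (θ c : ℝ) : Prop :=
  ∀ z : ℂ, c < z.im →
    IntegrableOn (fun x : ℝ => (limKernel θ x : ℂ) * Complex.exp (Complex.I * z * (x : ℂ))) (Set.Ioi 0) ∧
      ∫ x in Set.Ioi (0 : ℝ), (limKernel θ x : ℂ) * Complex.exp (Complex.I * z * (x : ℂ)) = limTheta θ z

/-- RH-FREE hypothesis package: `K_θ` is continuous, vanishes on `(-∞,0)`, satisfies `|K_θ(x)| ≤ C e^{cx}`
for `x ≥ 0`, and has the Laplace identity on `Im z > c` ([Su20] Thm 1.2 (K-ii)∧(K-iii)-shaped; the cell's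
`LimKernelBasic` is the case `c = 1/2`). -/
def LimKernelBasicOn (θ c : ℝ) : Prop :=
  Continuous (limKernel θ) ∧ (∀ x : ℝ, x < 0 → limKernel θ x = 0) ∧
    (∃ C : ℝ, ∀ x : ℝ, 0 ≤ x → |limKernel θ x| ≤ C * Real.exp (c * x)) ∧
      LimKernelLaplaceIdentityOn θ c


/-- RH-FREE object. `unitLaplace z = ∫_0^1 e^{-izy} dy` (`= (e^{-iz} - 1)/(-iz)` for `z ≠ 0`), the Laplace
transform of the unit window: the entire denominator `F` of the quotient representation `Θ_θ · F = G`
produced by a square-integrable `W_θ` (H1). -/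
def unitLaplace (z : ℂ) : ℂ :=
  ∫ y in Set.Ioo (0 : ℝ) 1, Complex.exp (-(Complex.I * z) * (y : ℂ))

end Summit.RiemannHypothesis.RiemannHypothesis.Theorems.SuzukiDoor

/-! ## Crux-skeleton vocabulary (appended 2026-08-25, rh-dbr-eng g3)

The BC3 birth skeletons of the cruxes `KernelSupport` (stmt-RiemannHypothesis-19727) and
`KernelLaplaceIdentity` (stmt-RiemannHypothesis-19726) (planner rh-dbr-theory g4; HOME
`rh-dbr-theory/lean/route-DeBrangesSuzukiDoor/*_line_birth.lean`, sha16 6b04a5da75418a33 / c189badcad3d5763;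
registered with `ledger skeleton check`) state their stubs over two LOCAL definitions `invFL` (verbatim
`Literature.NumberTheory.LFunctions.invFourierLine`) and `thetaSym` (verbatim the route's `let Θ` =
`SuzukiDoor.limTheta`) in the namespaces `…Cruxes.KernelSupport.Birth` and `…Cruxes.KernelLaplaceIdentity.Birth`.
They are declared here, verbatim, so that stub proofs filed under `Theorems/` state the registered signatures
BY NAME; the skeletons then import this module instead of their local copies. All four are definitionally
equal to the Literature / `SuzukiDoor` objects (`rfl`). RH-FREE bookkeeping. -/

namespace Summit.RiemannHypothesis.RiemannHypothesis.Cruxes.KernelSupport.Birth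

open Literature.NumberTheory.LFunctions

/-- Inverse Fourier transform along `Im z = c`: `(1/2π) ∫ Φ(u+ic) e^{-i(u+ic)x} du` (verbatim
`Literature.NumberTheory.LFunctions.invFourierLine`; skeleton-local name). RH-FREE object. -/
def invFL (Φ : ℂ → ℂ) (c : ℝ) (x : ℝ) : ℂ :=
  (1 : ℂ) / (2 * (Real.pi : ℂ)) * ∫ u : ℝ, Φ (u + c * Complex.I) * Complex.exp (-Complex.I * (u + c * Complex.I) * x)

/-- Suzuki's single symbol `Θ_θ(z) = exp(−2θ (ξ′/ξ)(½ − iz))` (verbatim the route's `let Θ`; skeleton-local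
name; `= SuzukiDoor.limTheta θ` by `rfl`). RH-FREE object. -/
def thetaSym (θ : ℝ) : ℂ → ℂ := fun z => Complex.exp (-2 * (θ : ℂ) *
  (deriv riemannXi (1 / 2 - Complex.I * z) / riemannXi (1 / 2 - Complex.I * z)))

end Summit.RiemannHypothesis.RiemannHypothesis.Cruxes.KernelSupport.Birth

namespace Summit.RiemannHypothesis.RiemannHypothesis.Cruxes.KernelLaplaceIdentity.Birth

open Literature.NumberTheory.LFunctions

/-- Inverse Fourier transform along `Im z = c` (verbatim `Literature.NumberTheory.LFunctions.invFourierLine`;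
skeleton-local name of the K4 skeleton). RH-FREE object. -/
def invFL (Φ : ℂ → ℂ) (c : ℝ) (x : ℝ) : ℂ :=
  (1 : ℂ) / (2 * (Real.pi : ℂ)) * ∫ u : ℝ, Φ (u + c * Complex.I) * Complex.exp (-Complex.I * (u + c * Complex.I) * x)

/-- Suzuki's single symbol (verbatim the route's `let Θ`; skeleton-local name of the K4 skeleton). RH-FREE object. -/
def thetaSym (θ : ℝ) : ℂ → ℂ := fun z => Complex.exp (-2 * (θ : ℂ) *
  (deriv riemannXi (1 / 2 - Complex.I * z) / riemannXi (1 / 2 - Complex.I * z)))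

end Summit.RiemannHypothesis.RiemannHypothesis.Cruxes.KernelLaplaceIdentity.Birth

end
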